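import Summits.NavierStokesRegularity.FluidComputer.RowModelSound
import Summits.NavierStokesRegularity.FluidComputer.RowPhaseCont
import Mathlib.Analysis.Calculus.MeanValue
import HarnessLib

/-!
# The row model, part 5: continuation of the phase map along a row — the phase speed does not vanish,
# the phase map is Lipschitz, and THE EXTENSION STEP (layer A′, `pub-fluidc-bp3/R1-DESIGN.md` §11.7 (G-b)–(G-d))

HONEST FRAMING (cell `pub-fluidc`, blueprint seat bp3, gen 22): low prior, high value-of-information
experiment on Tao's machine paradigm; NOT a claim that NS blows up.

WHY. `row_sound_on` closes the tube on the part `[T₀, Ts]` of a row reached by a member's phase map.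
To CONSTRUCT the phase map along the whole row one bootstraps: (G-b) on the reached part the member's own
phase speed `ẏ_p(s t) = x̂'_p + Ṽ_p` does not vanish (`|Ṽ_p| ≤ D_p < Φlo ≤ |x̂'_p|`; `Fy_p_ne_zero`) and
`|ṡ| ≤ 1 + ρ`, so `s` is `(1+ρ)`-Lipschitz (`abs_s_sub_le`, one-sided mean value theorem — the input of
the closedness half of the bootstrap); (G-c) `phase_step`: if `Ts < T₁` and the field-plus-defect
`σ ↦ F_p(y σ) + δF_p σ` is continuous on the open domain `D`, then the phase map extends to some
`[T₀, T']`, `Ts < T' ≤ T₁`, with every phase-dependent property `MemberOn T'` asks (continuity, right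
derivative, values in `D`, the lock), agreeing with the old map on `[T₀, Ts]`: the window, sign and
duration come from `Reparam.phase_extend`, the new piece is `ψ⁻¹ ∘ (ε x̂_p)` glued at `Ts`. The
conclusions are plain propositions about the pair `(s', sd')`, so that both the abstract bootstrap and the
`RowData` level can rebuild the member record (`memberOn_of_tube`: the two phase-independent hypotheses
are the ODE with defect on `D` and the defect class in TUBE form — layer R's deliverable).

[cite: Tao2016AveragedNS, §5.5 Thm 5.3 (5.5)]
-/

noncomputable section

namespace Summit.NavierStokesRegularity.FluidComputer

namespace RowModel

open Set Real Filter Topology Matrix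

variable {ι : Type*} {κ : Type*} [Fintype ι] [Fintype κ] (R : RowModel ι κ) [DecidableEq κ] [DecidableEq ι]
variable {R}

/-- **(G-b) The member's phase speed does not vanish on the reached part of the row**:
`F_p(y(s t)) + δF_p(s t) = x̂'_p(t) + Ṽ_p(t) ≠ 0` since `|Ṽ_p| ≤ D_p < Φlo ≤ |x̂'_p|`. [folklore] -/
theorem Fy_p_ne_zero (hc : R.Cert) {Ts : ℝ} (hm : R.MemberOn Ts) (hTs0 : R.T₀ ≤ Ts) (hTs : Ts ≤ R.T₁)
    (hu : ∀ i, |R.z R.T₀ i| ≤ R.ub 0 i) {t : ℝ} (ht : t ∈ Icc R.T₀ Ts) :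
    R.F (R.y (R.s t)) R.p + R.δF (R.s t) R.p ≠ 0 := by
  have hE := (row_sound_on hc hm hTs0 hTs hu).1 t ht
  have hV := Vp_le hc hm hTs ht hE
  have hΦ := hc.hΦ t ⟨ht.1, ht.2.trans hTs⟩
  rw [Fy_add hc]
  intro h0
  have h1 : R.xh' t R.p = -R.Vt t R.p := by linarith
  rw [h1, abs_neg] at hΦ
  linarith [hc.hDp]

/-- **The phase map is `(1+ρ)`-Lipschitz on the reached part** (`|ṡ − 1| ≤ ρ` from `row_sound_on` and
the one-sided mean value inequality). [folklore] -/
theorem abs_s_sub_le (hc : R.Cert) {Ts : ℝ} (hm : R.MemberOn Ts) (hTs0 : R.T₀ ≤ Ts) (hTs : Ts ≤ R.T₁)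
    (hu : ∀ i, |R.z R.T₀ i| ≤ R.ub 0 i) {t t' : ℝ} (ht : t ∈ Icc R.T₀ Ts) (ht' : t' ∈ Icc R.T₀ Ts)
    (htt' : t ≤ t') : |R.s t' - R.s t| ≤ (1 + R.ρ) * (t' - t) := by
  have hρ := (row_sound_on hc hm hTs0 hTs hu).2.2.2
  have hf : ContinuousOn R.s (Icc t t') := hm.hsc.mono (Icc_subset_Icc ht.1 ht'.2)
  have hf' : ∀ x ∈ Ico t t', HasDerivWithinAt R.s (R.sd x) (Ici x) x :=
    fun x hx => hm.hsd x ⟨ht.1.trans hx.1, lt_of_lt_of_le hx.2 ht'.2⟩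
  have hb : ∀ x ∈ Ico t t', ‖R.sd x‖ ≤ 1 + R.ρ := fun x hx => by
    have h := hρ x ⟨ht.1.trans hx.1, lt_of_lt_of_le hx.2 ht'.2⟩
    rw [Real.norm_eq_abs]
    have h2 := abs_sub_abs_le_abs_sub (R.sd x) 1
    rw [abs_one] at h2
    linarith
  have h := norm_image_sub_le_of_norm_deriv_right_le_segment hf hf' hb t' (right_mem_Icc.mpr htt')
  rwa [Real.norm_eq_abs] at h

/-- **(G-c) The extension step of the bootstrap.** On a row with `Ts < T₁` reached by a member
(`MemberOn Ts`, certified tables, carried start box), if `D` is open and `σ ↦ F_p(y σ) + δF_p σ` is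
continuous on `D`, then there are `T' ∈ (Ts, T₁]` and a pair `(s', sd')` agreeing with `(s, sd)` on
`[T₀, Ts]` (resp. `[T₀, Ts)`) with: `s'` continuous on `[T₀, T']`, right derivative `sd'` on `[T₀, T')`,
values in `D`, and the lock `y_p(s' t) = x̂_p(t)` on `[T₀, T']`. [folklore] -/
theorem phase_step (hc : R.Cert) {Ts : ℝ} (hm : R.MemberOn Ts) (hTs0 : R.T₀ ≤ Ts) (hTs : Ts < R.T₁)
    (hu : ∀ i, |R.z R.T₀ i| ≤ R.ub 0 i) (hDo : IsOpen R.D)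
    (hFc : ContinuousOn (fun σ => R.F (R.y σ) R.p + R.δF σ R.p) R.D) :
    ∃ T' : ℝ, Ts < T' ∧ T' ≤ R.T₁ ∧ ∃ s' sd' : ℝ → ℝ,
      (∀ t ∈ Icc R.T₀ Ts, s' t = R.s t) ∧ (∀ t ∈ Ico R.T₀ Ts, sd' t = R.sd t) ∧
      ContinuousOn s' (Icc R.T₀ T') ∧
      (∀ t ∈ Ico R.T₀ T', HasDerivWithinAt s' (sd' t) (Ici t) t) ∧
      (∀ t ∈ Icc R.T₀ T', s' t ∈ R.D) ∧
      (∀ t ∈ Icc R.T₀ T', R.y (s' t) R.p = R.xh t R.p) := by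
  -- the open set `U ⊆ D` where the phase speed does not vanish
  set ψ' : ℝ → ℝ := fun σ => R.F (R.y σ) R.p + R.δF σ R.p with hψ'
  set U : Set ℝ := R.D ∩ ψ' ⁻¹' ({0} : Set ℝ)ᶜ with hUdef
  have hU : IsOpen U := hFc.isOpen_inter_preimage hDo isOpen_compl_singleton
  have hd : ∀ σ ∈ U, HasDerivAt (fun σ => R.y σ R.p) (ψ' σ) σ := fun σ hσ => hm.hy σ hσ.1 R.p
  have hne : ∀ σ ∈ U, ψ' σ ≠ 0 := fun σ hσ h0 => hσ.2 h0
  have hTsI : Ts ∈ Icc R.T₀ Ts := ⟨hTs0, le_rfl⟩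
  have hσ₁ : R.s Ts ∈ U := ⟨hm.hsD Ts hTsI, Fy_p_ne_zero hc hm hTs0 hTs.le hu hTsI⟩
  have hχc : ContinuousWithinAt (fun t => R.xh t R.p) (Ici Ts) Ts :=
    (hc.hxh Ts R.p).continuousAt.continuousWithinAt
  have hχτ : (fun t => R.xh t R.p) Ts = (fun σ => R.y σ R.p) (R.s Ts) := (hm.hlock Ts hTsI).symm
  obtain ⟨a, b, ε, η, hab, _, _, hwin, hε, hη, hψc, hψm, hrange, hinv⟩ :=
    Reparam.phase_extend hU hd hne hσ₁ hχc hχτ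
  have hε0 : ε ≠ 0 := by rcases hε with h | h <;> rw [h] <;> norm_num
  -- the new extent
  set T' : ℝ := min (Ts + η) R.T₁ with hT'
  have hT'1 : Ts < T' := lt_min (by linarith) hTs
  have hT'2 : T' ≤ R.T₁ := min_le_right _ _
  have hT'3 : T' ≤ Ts + η := min_le_left _ _
  have hrange' : ∀ t ∈ Icc Ts T', ε * R.xh t R.p ∈ Ioo (ε * R.y a R.p) (ε * R.y b R.p) :=
    fun t ht => hrange t ⟨ht.1, ht.2.trans hT'3⟩
  -- the new piece `g := ψ⁻¹ ∘ (ε x̂_p)` and the glued pair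
  set g : ℝ → ℝ := fun t => Reparam.inv hab hψc hψm (ε * R.xh t R.p) with hg
  have hgTs : g Ts = R.s Ts := hinv
  have hgI : ∀ t ∈ Icc Ts T', g t ∈ Ioo a b :=
    fun t ht => Reparam.inv_mem_Ioo hab hψc hψm (hrange' t ht)
  have hgU : ∀ t ∈ Icc Ts T', g t ∈ U := fun t ht => hwin (Ioo_subset_Icc_self (hgI t ht))
  have hglock : ∀ t ∈ Icc Ts T', R.y (g t) R.p = R.xh t R.p := fun t ht =>
    mul_left_cancel₀ hε0 (Reparam.apply_inv hab hψc hψm (Ioo_subset_Icc_self (hrange' t ht)))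
  have hxc : ContinuousOn (fun t => ε * R.xh t R.p) (Icc Ts T') :=
    continuousOn_const.mul fun t _ => (hc.hxh t R.p).continuousAt.continuousWithinAt
  have hgc : ContinuousOn g (Icc Ts T') := Reparam.reparam_continuousOn hab hψc hψm hxc
  have hgd : ∀ t ∈ Ico Ts T', HasDerivWithinAt g (R.xh' t R.p / ψ' (g t)) (Ici t) t := by
    intro t ht
    have htc : t ∈ Icc Ts T' := Ico_subset_Icc_self ht
    have hgtU := hgU t htc
    have hψd : HasDerivAt (fun σ => ε * R.y σ R.p) (ε * ψ' (g t))
        (Reparam.inv hab hψc hψm (ε * R.xh t R.p)) := (hm.hy (g t) hgtU.1 R.p).const_mul ε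
    have hne' : ε * ψ' (g t) ≠ 0 := mul_ne_zero hε0 (hne (g t) hgtU)
    have h := Reparam.reparam_hasDerivWithinAt hab hψc hψm (χ := fun r => ε * R.xh r R.p) (t := t)
      (hrange' t htc) (((hc.hxh t R.p).hasDerivWithinAt (s := Ici t)).const_mul ε) hψd hne'
    have hval : ε * R.xh' t R.p / (ε * ψ' (g t)) = R.xh' t R.p / ψ' (g t) :=
      mul_div_mul_left _ _ hε0
    rw [hval] at h
    exact h
  set s' : ℝ → ℝ := fun t => if t ≤ Ts then R.s t else g t with hs'
  set sd' : ℝ → ℝ := fun t => if t < Ts then R.sd t else R.xh' t R.p / ψ' (g t) with hsd'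
  have hs's : ∀ t, t ≤ Ts → s' t = R.s t := fun t ht => by simp only [hs', if_pos ht]
  have hs'g : ∀ t, Ts ≤ t → s' t = g t := fun t ht => by
    by_cases h : t ≤ Ts
    · rw [hs's t h, le_antisymm h ht, hgTs]
    · simp only [hs', if_neg h]
  refine ⟨T', hT'1, hT'2, s', sd', fun t ht => hs's t ht.2,
    fun t ht => by simp only [hsd', if_pos ht.2], ?_, ?_, ?_, ?_⟩
  · -- continuity on `[T₀, Ts] ∪ [Ts, T']`
    have h1 : ContinuousOn s' (Icc R.T₀ Ts) := hm.hsc.congr fun t ht => hs's t ht.2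
    have h2 : ContinuousOn s' (Icc Ts T') := hgc.congr fun t ht => hs'g t ht.1
    have h := h1.union_of_isClosed h2 isClosed_Icc isClosed_Icc
    rwa [Icc_union_Icc_eq_Icc hTs0 hT'1.le] at h
  · -- right derivative
    intro t ht
    rcases lt_or_ge t Ts with hlt | hge
    · have h := hm.hsd t ⟨ht.1, hlt⟩
      have hval : sd' t = R.sd t := by simp only [hsd', if_pos hlt]
      rw [hval]
      refine h.congr_of_eventuallyEq ?_ (hs's t hlt.le)
      filter_upwards [inter_mem_nhdsWithin (Ici t) (Iio_mem_nhds hlt)] with r hr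
      exact hs's r (le_of_lt hr.2)
    · have h := hgd t ⟨hge, ht.2⟩
      have hval : sd' t = R.xh' t R.p / ψ' (g t) := by simp only [hsd', if_neg (not_lt.mpr hge)]
      rw [hval]
      refine h.congr_of_eventuallyEq ?_ (hs'g t hge)
      filter_upwards [self_mem_nhdsWithin] with r hr
      exact hs'g r (le_trans hge hr)
  · -- values in `D`
    intro t ht
    rcases le_or_gt t Ts with hle | hgt
    · rw [hs's t hle]; exact hm.hsD t ⟨ht.1, hle⟩
    · rw [hs'g t hgt.le]; exact (hgU t ⟨hgt.le, ht.2⟩).1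
  · -- the lock
    intro t ht
    rcases le_or_gt t Ts with hle | hgt
    · rw [hs's t hle]; exact hm.hlock t ⟨ht.1, hle⟩
    · rw [hs'g t hgt.le]; exact hglock t ⟨hgt.le, ht.2⟩

omit [Fintype ι] [Fintype κ] [DecidableEq κ] [DecidableEq ι] in
/-- **The member record from the tube**: for a model whose phase map has the four phase-dependent
properties on `[T₀, T']`, `T' ≤ T₁` (e.g. rebuilt from `phase_step`), the two phase-INDEPENDENT
hypotheses — the ODE with defect on `D`, and the defect class in TUBE form (wherever the member is within
`Ē` of the reference on the row; layer R's deliverable) — give `MemberOn T'`. [folklore] -/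
def memberOn_of_tube {T' : ℝ} (hT' : T' ≤ R.T₁)
    (hy : ∀ σ ∈ R.D, ∀ a, HasDerivAt (fun r => R.y r a) (R.F (R.y σ) a + R.δF σ a) σ)
    (htube : ∀ σ ∈ R.D, ∀ t ∈ Icc R.T₀ R.T₁, (∀ a, |R.y σ a - R.xh t a| ≤ R.Ebar a) →
      ∀ a, |R.δF σ a| ≤ R.δ a)
    (hsc : ContinuousOn R.s (Icc R.T₀ T'))
    (hsd : ∀ t ∈ Ico R.T₀ T', HasDerivWithinAt R.s (R.sd t) (Ici t) t)
    (hsD : ∀ t ∈ Icc R.T₀ T', R.s t ∈ R.D)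
    (hlock : ∀ t ∈ Icc R.T₀ T', R.y (R.s t) R.p = R.xh t R.p) : R.MemberOn T' :=
  { hy := hy
    hsc := hsc
    hsd := hsd
    hsD := hsD
    hlock := hlock
    hδ := fun t ht hE a => htube (R.s t) (hsD t ht) t ⟨ht.1, ht.2.trans hT'⟩ hE a }

end RowModel

end Summit.NavierStokesRegularity.FluidComputer
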